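import Summits.HodgeConjecture.HodgeConjecture.Theorems.F0P3SpectralPacketRigidityGOfCore   -- ★ p848182 (O3 closer) + ★ p848041 `SphericalRigidity` (Satake at the good places) + ★ p847962 `xiRigidityGHom_of_marker_laws`
import Summits.HodgeConjecture.HodgeConjecture.Theorems.F0P3SpectralPacketRigidityHOfKR     -- ★ p848874 (O5 closer) + ★ p848117 `ReductionH` (`xiRigidityH_of_fibre`, `fibreH_of_marker_laws`)
import HarnessLib

/-!
# THE O3∕O5 RIGIDITY STACK WITH THE UNRAMIFIED LAW READ ONLY OFF THE GUARD — `(h4 : ∀ v ∉ S₀, (𝔩 v).UnramLaw)` siblings of ★ `SphericalRigidity` §2–§3, ★ `RigidityGOfCore`, ★ `RigidityReductionH` §2–§3, ★ `RigidityHOfKR` §2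
# (docket F13 «JQ-RAM», STANDING DEFECT M-159; Rogawski §4.5 p. 49, §13.3 p. 203 l. 1–3, §13.7 p. 206, §13.8 p. 216 last ¶)

Cell `hodgecm-mathlib`, F0∕P3c line LH7 (leaf `Cruxes/H413/Lines/F0_P3c_PKtuplePaydown.lean` ED. 6 d04978fb87efb1ea, organ ties O3 `stub_PKrigidGOfCore` :713 ∕ O5 `stub_PKrigidHOfKR` :819),
crux H413 = `stmt-HodgeConjecture-24833`; typist LH7-typ1 (g3), default D2′ 2026-09-04T23:3xZ on the S7 box LH7-audit1 (g2)'s «CHEAPEST RE-TIE» (`F0/P3c/LH7/LH7-audit1/g2/F13-S7-BLAST-RADIUS.LH7-audit1-g2.md`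
e485715193d74b6d) and the typist census `F0/P3c/LH7/LH7-typ1/g3/F13-LEAF-USESITES.v1.md` 93376ab6fd3c01a7 §3; `--supports stmt-HodgeConjecture-24833`; closes no stub; ADDITIVE SIBLINGS (rule 69):
the ★ originals stay byte-identical and keep their consumers.

THE MATHEMATICS.  Print reads the unramified law (ℓ4) — «`Π_v` unramified ⇒ its `K_v`-spherical member `π_v⁰` lies in `Π_v`, is the unique spherical member, `⟨1, π_v⁰⟩ = 1`, `⟨ρ, π_v⁰⟩ = 1`»
[Rogawski1990 Thm. 13.1.1 p. 198; §13.3 p. 203 l. 1–3] — only at places where `G_v` is unramified and `K_v` hyperspecial [§4.5 p. 49]; at a place of `L⁺` ramified in `L` the packet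
`Π(θ_v^{φ₀})` of a semi-regular `θ_v` contains a `K_v`-spherical member `π²` with `⟨ρ, π²⟩ = −1` [Prop. 13.1.3 (c) p. 199; §13.8 p. 216 last ¶], so the kit law `∀ v, (𝔩 v).UnramLaw` (row (KG1) of
`TupleKitLawsK2`) is not met by the print-faithful kit (director s2022 M-159 «JQ-RAM»; REF5 R5-371; R90-TF LEAD #36 (A)).  Every READ of (KG1) on the O3∕O5 paths happens at a place `v ∉ S₀`
(★ `RigidityGOfCore` :96, ★ `SphericalRigidity` :181, ★ `RigidityReductionH` :138 — the guard `S₀` off which `ψ_v(K′_v) = K_v`), so the whole stack holds VERBATIM under the weaker hypothesis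
`(h4 : ∀ v ∉ S₀, (𝔩 v).UnramLaw)`: this file restates the eleven family theorems with that hypothesis (bound right after `hψK`, since it mentions `S₀`) and the proofs of the originals with the
one token change `(h4 v)` ↦ `(h4 v hv₀)`.  The leaf ED. 7 then feeds `h4 := fun v hv => hKG1 v (HUR v ‹from hv›)` at `S₀ ⊇ {places of L⁺ ramified in L}` (the guarded row (KG1′)
`∀ v, Algebra.IsUnramifiedIn (𝓞 L) v.asIdeal → (𝔩 v).UnramLaw` of T-A ED. 6; heir LEAD RULING (R-39) (3), F13-SCOPE (a)–(d)), whichever way the window pen words the letter (an explicit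
`hHUR : ∀ v ∉ S₀, HUR v` binder, or `S₀` enlarged by the finite set ★ `finite_setOf_not_isUnramifiedIn` inside the organ bodies).

CONTENTS (suffix `_offS`; namespaces of the originals): `SpectralPacketG.{πn_mem_of_eqOff_offS, transport_πn_mem_of_eqOff_offS, exists_transport_πn_mem_of_eqOff_offS,
xiRigidityGHom_of_marker_laws_of_meet_offS, eventually_mem_eq_transport_πn_of_eqOff_offS, meets_of_core_of_eqOff_offS, xiRigidityGHom_of_marker_laws_of_core_offS}` (O3 path) and
`SpectralPacketH.{transport_πn_mem_xiH_of_eqOff_offS, xiRigidityH_of_fibre_offS, xiRigidityH_of_marker_laws_offS, xiRigidityH_of_KR_offS}` (O5 path).  No instance, no notation, no named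
fact, no new definition, no `sorry`.
HONEST LABEL: HC_CM is proved only modulo the 7 printed citations (2 remaining named inputs: hLiu418 = stmt-HodgeConjecture-24832, h413 = stmt-HodgeConjecture-24833) until rung 0 closes;
STANDING DEFECT M-159 «JQ-RAM» is carried until the F13 re-type is BUILT; this file proves no printed statement — it re-cuts in-house glue under a weaker hypothesis.

References: [Rogawski1990] §4.5 p. 49; §13.1 Thm. 13.1.1 p. 198, Prop. 13.1.3 (c)(d) p. 199, p. 199 ¶2; §13.3 Thms. 13.3.2∕13.3.4∕13.3.5∕13.3.6 (c) p. 202, p. 203 l. 1–3, ¶2; §13.7 p. 206;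
§13.8 p. 216 last ¶; §12.2 p. 174 l. 1.  [CartierCorvallis1979] §IV.1 Cor. 4.1.
-/

set_option autoImplicit false
-- the mandated namespace repeats `HodgeConjecture.HodgeConjecture`, as in every `Theorems/*.lean` of this sub-problem
set_option linter.dupNamespace false

noncomputable section

open NumberField IsDedekindDomain MeasureTheory Filter
open scoped Matrix MatrixGroups

open Literature.NumberTheory Literature.NumberTheory.Automorphic Literature.NumberTheory.Automorphic.UnitaryGroup
open Literature.NumberTheory.Rogawski1990 Literature.NumberTheory.GaloisRepresentations
open Literature.RepresentationTheory.BorelWallach2000 Literature.RepresentationTheory.KonnoKonno2007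
open Summit.HodgeConjecture.HodgeConjecture.Cruxes.H413.F0P3InnerFormClassificationV6 (splitForm EvpData EqOff)
open Summit.HodgeConjecture.HodgeConjecture.Cruxes.H413.F0P3LocalPacketKit
open Summit.HodgeConjecture.HodgeConjecture.Cruxes.H413.F0P3ArchPacketKit

/-! ## §1 The `G`-side (O3 path): Satake at every good place, some good place, (L1″) with the rigid core — off `S₀` only [§13.7 p. 206; Thm. 13.3.5, 13.3.6 (c)] -/

namespace Summit.HodgeConjecture.HodgeConjecture.Cruxes.H413.F0P3SpectralPacket.SpectralPacketG

open Summit.HodgeConjecture.HodgeConjecture.Cruxes.H413.F0P3GlobalPacket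

variable {L : Type} [Field L] [NumberField L] [IsCMField L] {H : Matrix (Fin 3) (Fin 3) L}
  {𝔩 : ∀ v : HeightOneSpectrum (𝓞 ↥(maximalRealSubfield L)), LocalPacketKit L (splitForm L 3) v} {𝔞 : ArchPacketKit}
  {μ : Measure (adelicGroupData (↥(maximalRealSubfield L)) L (IsCMField.complexConj L) 3 (splitForm L 3)).automorphicQuotient}
  [SMulInvariantMeasure (adelicGroupData (↥(maximalRealSubfield L)) L (IsCMField.complexConj L) 3 (splitForm L 3)).Adelic
    (adelicGroupData (↥(maximalRealSubfield L)) L (IsCMField.complexConj L) 3 (splitForm L 3)).automorphicQuotient μ]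
  [∀ v : HeightOneSpectrum (𝓞 ↥(maximalRealSubfield L)), MeasurableSpace ((cmDatum L 3 (splitForm L 3)).Local v)]
  [∀ v : HeightOneSpectrum (𝓞 ↥(maximalRealSubfield L)), BorelSpace ((cmDatum L 3 (splitForm L 3)).Local v)]
  [∀ v : HeightOneSpectrum (𝓞 ↥(maximalRealSubfield L)), MeasurableSpace ((cmDatum L 3 H).Local v)]
  [∀ v : HeightOneSpectrum (𝓞 ↥(maximalRealSubfield L)), BorelSpace ((cmDatum L 3 H).Local v)]
  {νG' : ∀ v : HeightOneSpectrum (𝓞 ↥(maximalRealSubfield L)), Measure ((cmDatum L 3 H).Local v)}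
  [∀ v, (νG' v).IsMulLeftInvariant] [∀ v, IsFiniteMeasureOnCompacts (νG' v)]
  {ψ : ∀ v : HeightOneSpectrum (𝓞 ↥(maximalRealSubfield L)), (cmDatum L 3 H).Local v ≃ₜ* (cmDatum L 3 (splitForm L 3)).Local v}
  {Pk' : OneDimAutRepH L → ∀ v : HeightOneSpectrum (𝓞 ↥(maximalRealSubfield L)), CMLocalAPacket L H v}
  {ram : OneDimAutRepH L → Finset (HeightOneSpectrum (𝓞 ↥(maximalRealSubfield L)))}

/-- **EVERY GOOD PLACE, (KG1) read off `S₀` only** — sibling of ★ `πn_mem_of_eqOff` with `(h4 : ∀ v ∉ S₀, (𝔩 v).UnramLaw)`: if `t(Q) = t(ξ)` off `S ⊇ ramG Q`, then `πⁿ(ξ_v) ∘ ψ_v⁻¹ ∈ Q_v` for every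
`v ∉ S ∪ S₀ ∪ ram ξ`. [cite: Rogawski1990, §13.7 p. 206; §13.3 Thm. 13.3.5 p. 202, p. 203 l. 1–3; §4.5 p. 49] [cite: CartierCorvallis1979, §IV.1 Cor. 4.1] -/
theorem πn_mem_of_eqOff_offS
    (hKG3 : ∀ (v : HeightOneSpectrum (𝓞 ↥(maximalRealSubfield L))) (P : (𝔩 v).Pkt), ∀ π ∈ (𝔩 v).mem P, π.IsAdmissible)
    (S₀ : Finset (HeightOneSpectrum (𝓞 ↥(maximalRealSubfield L))))
    (hψK : ∀ v ∉ S₀, (cmLocalIntegralLevel L 3 H v).map (ψ v : (cmDatum L 3 H).Local v →* (cmDatum L 3 (splitForm L 3)).Local v) =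
      cmLocalIntegralLevel L 3 (splitForm L 3) v)
    (h4 : ∀ v ∉ S₀, (𝔩 v).UnramLaw)
    (hvol : ∀ v : HeightOneSpectrum (𝓞 ↥(maximalRealSubfield L)), (νG' v).real (cmLocalIntegralLevel L 3 H v : Set ((cmDatum L 3 H).Local v)) ≠ 0)
    (hsph : ∀ (ξ : OneDimAutRepH L), ∀ v ∉ ram ξ, (Pk' ξ v).πn.IsSpherical (cmLocalIntegralLevel L 3 H v))
    (hadmn : ∀ (ξ : OneDimAutRepH L) (v : HeightOneSpectrum (𝓞 ↥(maximalRealSubfield L))), (Pk' ξ v).πn.IsAdmissible)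
    {t : OneDimAutRepH L → EvpData L H}
    (ht : ∀ (ξ : OneDimAutRepH L), ∀ v ∉ ram ξ, t ξ v = (Pk' ξ v).πn.eigencharacter (cmLocalIntegralLevel L 3 H v) (νG' v))
    (ξ : OneDimAutRepH L) {S : Finset (HeightOneSpectrum (𝓞 ↥(maximalRealSubfield L)))} {Q : SpectralPacketG 𝔩 𝔞 μ}
    (hevp : EqOff L H S (Q.evpGψ ψ (fun w => (νG' w).map (ψ w))) (t ξ)) (hram : Q.fin.ramFinset ⊆ S)
    {v : HeightOneSpectrum (𝓞 ↥(maximalRealSubfield L))} (hvS : v ∉ S) (hv₀ : v ∉ S₀) (hvr : v ∉ ram ξ) :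
    IrrClass.comap (ψ v).symm (Pk' ξ v).πn ∈ (𝔩 v).mem (Q.fin.loc v) :=
  Q.comap_symm_mem_of_evpGψ_eq (h4 v hv₀) (hKG3 v _) (hψK v hv₀) (hvol v) (Q.fin.unr_of_not_mem_ramFinset fun h => hvS (hram h)) (hadmn ξ v) (hsph ξ v hvr)
    ((hevp v hvS).trans (ht ξ v hvr))

/-- **… in the transported currency, (KG1) off `S₀` only** — sibling of ★ `transport_πn_mem_of_eqOff`: `(transportAPackets ψ Pk′ ξ v).πn ∈ Q_v` for every `v ∉ S ∪ S₀ ∪ ram ξ`.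
[cite: Rogawski1990, §13.7 p. 206; §14.2 p. 232] [cite: CartierCorvallis1979, §IV.1 Cor. 4.1] -/
theorem transport_πn_mem_of_eqOff_offS
    (hKG3 : ∀ (v : HeightOneSpectrum (𝓞 ↥(maximalRealSubfield L))) (P : (𝔩 v).Pkt), ∀ π ∈ (𝔩 v).mem P, π.IsAdmissible)
    (S₀ : Finset (HeightOneSpectrum (𝓞 ↥(maximalRealSubfield L))))
    (hψK : ∀ v ∉ S₀, (cmLocalIntegralLevel L 3 H v).map (ψ v : (cmDatum L 3 H).Local v →* (cmDatum L 3 (splitForm L 3)).Local v) =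
      cmLocalIntegralLevel L 3 (splitForm L 3) v)
    (h4 : ∀ v ∉ S₀, (𝔩 v).UnramLaw)
    (hvol : ∀ v : HeightOneSpectrum (𝓞 ↥(maximalRealSubfield L)), (νG' v).real (cmLocalIntegralLevel L 3 H v : Set ((cmDatum L 3 H).Local v)) ≠ 0)
    (hsph : ∀ (ξ : OneDimAutRepH L), ∀ v ∉ ram ξ, (Pk' ξ v).πn.IsSpherical (cmLocalIntegralLevel L 3 H v))
    (hadmn : ∀ (ξ : OneDimAutRepH L) (v : HeightOneSpectrum (𝓞 ↥(maximalRealSubfield L))), (Pk' ξ v).πn.IsAdmissible)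
    {t : OneDimAutRepH L → EvpData L H}
    (ht : ∀ (ξ : OneDimAutRepH L), ∀ v ∉ ram ξ, t ξ v = (Pk' ξ v).πn.eigencharacter (cmLocalIntegralLevel L 3 H v) (νG' v))
    (ξ : OneDimAutRepH L) {S : Finset (HeightOneSpectrum (𝓞 ↥(maximalRealSubfield L)))} {Q : SpectralPacketG 𝔩 𝔞 μ}
    (hevp : EqOff L H S (Q.evpGψ ψ (fun w => (νG' w).map (ψ w))) (t ξ)) (hram : Q.fin.ramFinset ⊆ S)
    {v : HeightOneSpectrum (𝓞 ↥(maximalRealSubfield L))} (hvS : v ∉ S) (hv₀ : v ∉ S₀) (hvr : v ∉ ram ξ) :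
    (transportAPackets ψ Pk' ξ v).πn ∈ (𝔩 v).mem (Q.fin.loc v) := by
  rw [transportAPackets_πn]
  exact πn_mem_of_eqOff_offS hKG3 S₀ hψK h4 hvol hsph hadmn ht ξ hevp hram hvS hv₀ hvr

/-- **SOME GOOD PLACE, (KG1) off `S₀` only** — sibling of ★ `exists_transport_πn_mem_of_eqOff` (a number field has infinitely many finite places, ★ `infinite_heightOneSpectrum`).
[cite: Rogawski1990, §13.7 p. 206; §13.3 p. 199 ¶2] [cite: CartierCorvallis1979, §IV.1 Cor. 4.1] -/
theorem exists_transport_πn_mem_of_eqOff_offS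
    (hKG3 : ∀ (v : HeightOneSpectrum (𝓞 ↥(maximalRealSubfield L))) (P : (𝔩 v).Pkt), ∀ π ∈ (𝔩 v).mem P, π.IsAdmissible)
    (S₀ : Finset (HeightOneSpectrum (𝓞 ↥(maximalRealSubfield L))))
    (hψK : ∀ v ∉ S₀, (cmLocalIntegralLevel L 3 H v).map (ψ v : (cmDatum L 3 H).Local v →* (cmDatum L 3 (splitForm L 3)).Local v) =
      cmLocalIntegralLevel L 3 (splitForm L 3) v)
    (h4 : ∀ v ∉ S₀, (𝔩 v).UnramLaw)
    (hvol : ∀ v : HeightOneSpectrum (𝓞 ↥(maximalRealSubfield L)), (νG' v).real (cmLocalIntegralLevel L 3 H v : Set ((cmDatum L 3 H).Local v)) ≠ 0)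
    (hsph : ∀ (ξ : OneDimAutRepH L), ∀ v ∉ ram ξ, (Pk' ξ v).πn.IsSpherical (cmLocalIntegralLevel L 3 H v))
    (hadmn : ∀ (ξ : OneDimAutRepH L) (v : HeightOneSpectrum (𝓞 ↥(maximalRealSubfield L))), (Pk' ξ v).πn.IsAdmissible)
    {t : OneDimAutRepH L → EvpData L H}
    (ht : ∀ (ξ : OneDimAutRepH L), ∀ v ∉ ram ξ, t ξ v = (Pk' ξ v).πn.eigencharacter (cmLocalIntegralLevel L 3 H v) (νG' v))
    (ξ : OneDimAutRepH L) {S : Finset (HeightOneSpectrum (𝓞 ↥(maximalRealSubfield L)))} {Q : SpectralPacketG 𝔩 𝔞 μ}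
    (hevp : EqOff L H S (Q.evpGψ ψ (fun w => (νG' w).map (ψ w))) (t ξ)) (hram : Q.fin.ramFinset ⊆ S) :
    ∃ v : HeightOneSpectrum (𝓞 ↥(maximalRealSubfield L)), (transportAPackets ψ Pk' ξ v).πn ∈ (𝔩 v).mem (Q.fin.loc v) := by
  classical
  haveI : Infinite (HeightOneSpectrum (𝓞 ↥(maximalRealSubfield L))) := Literature.NumberTheory.Automorphic.infinite_heightOneSpectrum _
  obtain ⟨v, hv⟩ := Infinite.exists_notMem_finset (S ∪ S₀ ∪ ram ξ)
  simp only [Finset.mem_union, not_or] at hv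
  exact ⟨v, transport_πn_mem_of_eqOff_offS hKG3 S₀ hψK h4 hvol hsph hadmn ht ξ hevp hram hv.1.1 hv.1.2 hv.2⟩

variable {infOf : GlobalPacket 𝔩 → 𝔞.PktInf} {aTok : ∀ v : HeightOneSpectrum (𝓞 ↥(maximalRealSubfield L)), Set (𝔩 v).Pkt}
  {PkInf : OneDimAutRepH L → LocalAPacket (GKIrrClass (uFormGroup (Fin 2) (Fin 1)))} {κ : OneDimAutRepH L → ℤ}

/-- **(L1″) `XiRigidityGHom` FROM THE MARKER LAWS, (KG1) OFF `S₀` ONLY, (KG3′), THE GUARD AND Thm. 13.3.6 (c)** — sibling of ★ `xiRigidityGHom_of_marker_laws_of_meet`: ★ `xiRigidityGHom_of_marker_laws`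
(p847962) with its all-L hypothesis `hL` discharged by `exists_transport_πn_mem_of_eqOff_offS`.
[cite: Rogawski1990, §13.3 Thm. 13.3.5 p. 202, Thm. 13.3.6 (c) p. 202, p. 199 ¶2; §13.2 p. 200 l. 1–3; §13.7 p. 206; §4.5 p. 49] [cite: CartierCorvallis1979, §IV.1 Cor. 4.1] -/
theorem xiRigidityGHom_of_marker_laws_of_meet_offS
    {h : XiPacketsSignedHom 𝔩 𝔞 μ infOf aTok (transportAPackets ψ Pk') PkInf κ}
    (hKM1 : ∀ (v : HeightOneSpectrum (𝓞 ↥(maximalRealSubfield L))) (P P' : (𝔩 v).Pkt), (𝔩 v).mem P = (𝔩 v).mem P' → (∀ c, (𝔩 v).one P c = (𝔩 v).one P' c) →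
      (P ∈ aTok v ↔ P' ∈ aTok v) → P = P')
    (hKJ : ∀ (v : HeightOneSpectrum (𝓞 ↥(maximalRealSubfield L))) (P : (𝔩 v).Pkt) (c : IrrClass ((UnitaryGroup.cmDatum L 3 (splitForm L 3)).Local v)),
      c ∉ (𝔩 v).mem P → (𝔩 v).one P c = 0)
    (hKM2 : ∀ (ξ : OneDimAutRepH L) (v : HeightOneSpectrum (𝓞 ↥(maximalRealSubfield L))) (P : (𝔩 v).Pkt), P ∉ aTok v →
      (transportAPackets ψ Pk' ξ v).πn ∉ (𝔩 v).mem P)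
    (hKM3 : ∀ (ξ : OneDimAutRepH L) (v : HeightOneSpectrum (𝓞 ↥(maximalRealSubfield L))) (P : (𝔩 v).Pkt), P ∈ aTok v →
      ((transportAPackets ψ Pk' ξ v).πn ∈ (𝔩 v).mem P ∨ ∃ c, (transportAPackets ψ Pk' ξ v).πs = some c ∧ c ∈ (𝔩 v).mem P) →
      (∀ c, c ∈ (𝔩 v).mem P ↔ (c = (transportAPackets ψ Pk' ξ v).πn ∨ (transportAPackets ψ Pk' ξ v).πs = some c)) ∧
        (𝔩 v).one P (transportAPackets ψ Pk' ξ v).πn = 1 ∧ ∀ c ∈ (𝔩 v).mem P, c ≠ (transportAPackets ψ Pk' ξ v).πn → (𝔩 v).one P c = -1)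
    (hKG3 : ∀ (v : HeightOneSpectrum (𝓞 ↥(maximalRealSubfield L))) (P : (𝔩 v).Pkt), ∀ π ∈ (𝔩 v).mem P, π.IsAdmissible)
    (S₀ : Finset (HeightOneSpectrum (𝓞 ↥(maximalRealSubfield L))))
    (hψK : ∀ v ∉ S₀, (cmLocalIntegralLevel L 3 H v).map (ψ v : (cmDatum L 3 H).Local v →* (cmDatum L 3 (splitForm L 3)).Local v) =
      cmLocalIntegralLevel L 3 (splitForm L 3) v)
    (h4 : ∀ v ∉ S₀, (𝔩 v).UnramLaw)
    (hvol : ∀ v : HeightOneSpectrum (𝓞 ↥(maximalRealSubfield L)), (νG' v).real (cmLocalIntegralLevel L 3 H v : Set ((cmDatum L 3 H).Local v)) ≠ 0)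
    (hsph : ∀ (ξ : OneDimAutRepH L), ∀ v ∉ ram ξ, (Pk' ξ v).πn.IsSpherical (cmLocalIntegralLevel L 3 H v))
    (hadmn : ∀ (ξ : OneDimAutRepH L) (v : HeightOneSpectrum (𝓞 ↥(maximalRealSubfield L))), (Pk' ξ v).πn.IsAdmissible)
    {tXi : OneDimAutRepH L → EvpData L H}
    (ht : ∀ (ξ : OneDimAutRepH L), ∀ v ∉ ram ξ, tXi ξ v = (Pk' ξ v).πn.eigencharacter (cmLocalIntegralLevel L 3 H v) (νG' v))
    (hA : ∀ (ξ : OneDimAutRepH L) (S : Finset (HeightOneSpectrum (𝓞 ↥(maximalRealSubfield L)))) (Q : SpectralPacketG 𝔩 𝔞 μ),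
      Q.inf = infOf Q.fin → (∀ v, Q.fin.loc v ∈ aTok v) → EqOff L H S (Q.evpGψ ψ (fun w => (νG' w).map (ψ w))) (tXi ξ) → Q.fin.ramFinset ⊆ S →
      ∀ v, (transportAPackets ψ Pk' ξ v).πn ∈ (𝔩 v).mem (Q.fin.loc v) ∨ ∃ c, (transportAPackets ψ Pk' ξ v).πs = some c ∧ c ∈ (𝔩 v).mem (Q.fin.loc v)) :
    XiRigidityGHom h ψ (fun w => (νG' w).map (ψ w)) tXi :=
  xiRigidityGHom_of_marker_laws hKM1 hKJ hKM2 hKM3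
    (fun ξ _ Q _ _ hevp hram => exists_transport_πn_mem_of_eqOff_offS hKG3 S₀ hψK h4 hvol hsph hadmn ht ξ (Q := Q) hevp hram) hA

/-- **A MEMBER FAMILY OF A PACKET WITH THE ξ-GERM IS `πⁿ(ξ_v) ∘ ψ_v⁻¹` COFINITELY, (KG1) off `S₀` only** — sibling of ★ `eventually_mem_eq_transport_πn_of_eqOff` (Satake injectivity at every
`v ∉ S ∪ S₀ ∪ ram ξ`, ★ `sph_eq_comap_symm_of_evpAtψ_eq`). [cite: Rogawski1990, §13.3 p. 203 ¶2; §13.7 p. 206; §4.5 p. 49] [cite: CartierCorvallis1979, §IV.1 Cor. 4.1] -/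
theorem eventually_mem_eq_transport_πn_of_eqOff_offS
    (hKG3 : ∀ (v : HeightOneSpectrum (𝓞 ↥(maximalRealSubfield L))) (P : (𝔩 v).Pkt), ∀ π ∈ (𝔩 v).mem P, π.IsAdmissible)
    (S₀ : Finset (HeightOneSpectrum (𝓞 ↥(maximalRealSubfield L))))
    (hψK : ∀ v ∉ S₀, (cmLocalIntegralLevel L 3 H v).map (ψ v : (cmDatum L 3 H).Local v →* (cmDatum L 3 (splitForm L 3)).Local v) =
      cmLocalIntegralLevel L 3 (splitForm L 3) v)
    (h4 : ∀ v ∉ S₀, (𝔩 v).UnramLaw)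
    (hvol : ∀ v : HeightOneSpectrum (𝓞 ↥(maximalRealSubfield L)), (νG' v).real (cmLocalIntegralLevel L 3 H v : Set ((cmDatum L 3 H).Local v)) ≠ 0)
    (hsph : ∀ (ξ : OneDimAutRepH L), ∀ v ∉ ram ξ, (Pk' ξ v).πn.IsSpherical (cmLocalIntegralLevel L 3 H v))
    (hadmn : ∀ (ξ : OneDimAutRepH L) (v : HeightOneSpectrum (𝓞 ↥(maximalRealSubfield L))), (Pk' ξ v).πn.IsAdmissible)
    {t : OneDimAutRepH L → EvpData L H}
    (ht : ∀ (ξ : OneDimAutRepH L), ∀ v ∉ ram ξ, t ξ v = (Pk' ξ v).πn.eigencharacter (cmLocalIntegralLevel L 3 H v) (νG' v))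
    (ξ : OneDimAutRepH L) {S : Finset (HeightOneSpectrum (𝓞 ↥(maximalRealSubfield L)))} {Q : SpectralPacketG 𝔩 𝔞 μ}
    (hevp : EqOff L H S (Q.evpGψ ψ (fun w => (νG' w).map (ψ w))) (t ξ))
    {π : ∀ v : HeightOneSpectrum (𝓞 ↥(maximalRealSubfield L)), IrrClass ((cmDatum L 3 (splitForm L 3)).Local v)} (hπ : Q.fin.Mem π) :
    ∀ᶠ v in cofinite, π v = (transportAPackets ψ Pk' ξ v).πn := by
  classical
  have hfin : ∀ᶠ v in cofinite, v ∉ S ∪ S₀ ∪ ram ξ := (S ∪ S₀ ∪ ram ξ).eventually_cofinite_notMem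
  refine (hfin.and hπ.2).mono fun v hv => ?_
  obtain ⟨hvU, ⟨hunr, hsphv⟩⟩ := hv
  simp only [Finset.mem_union, not_or] at hvU
  obtain ⟨⟨hvS, hv₀⟩, hvr⟩ := hvU
  rw [hsphv, transportAPackets_πn]
  have heq : Q.fin.evpAtψ ψ (fun w => (νG' w).map (ψ w)) v = (Pk' ξ v).πn.eigencharacter (cmLocalIntegralLevel L 3 H v) (νG' v) := by
    rw [← Q.evpGψ_eq_evpAtψ]
    exact (hevp v hvS).trans (ht ξ v hvr)
  exact Q.fin.sph_eq_comap_symm_of_evpAtψ_eq ψ νG' (h4 v hv₀) (hψK v hv₀) (hvol v) hunr (hKG3 v _ _ (h4 v hv₀ _ hunr).1) (hadmn ξ v) (hsph ξ v hvr) heq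

/-- **WITH THE RIGID CORE, A DISCRETE PACKET WITH THE ξ-GERM MEETS `Π(ξ_v)` AT EVERY PLACE, (KG1) off `S₀` only** — sibling of ★ `meets_of_core_of_eqOff` (Thm. 13.3.6 (c), finite part, through
`hcore`). [cite: Rogawski1990, §13.3 Thm. 13.3.6 (c) p. 202, p. 203 ¶2; §13.7 p. 206] [cite: CartierCorvallis1979, §IV.1 Cor. 4.1] -/
theorem meets_of_core_of_eqOff_offS
    (hKG3 : ∀ (v : HeightOneSpectrum (𝓞 ↥(maximalRealSubfield L))) (P : (𝔩 v).Pkt), ∀ π ∈ (𝔩 v).mem P, π.IsAdmissible)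
    (S₀ : Finset (HeightOneSpectrum (𝓞 ↥(maximalRealSubfield L))))
    (hψK : ∀ v ∉ S₀, (cmLocalIntegralLevel L 3 H v).map (ψ v : (cmDatum L 3 H).Local v →* (cmDatum L 3 (splitForm L 3)).Local v) =
      cmLocalIntegralLevel L 3 (splitForm L 3) v)
    (h4 : ∀ v ∉ S₀, (𝔩 v).UnramLaw)
    (hvol : ∀ v : HeightOneSpectrum (𝓞 ↥(maximalRealSubfield L)), (νG' v).real (cmLocalIntegralLevel L 3 H v : Set ((cmDatum L 3 H).Local v)) ≠ 0)
    (hsph : ∀ (ξ : OneDimAutRepH L), ∀ v ∉ ram ξ, (Pk' ξ v).πn.IsSpherical (cmLocalIntegralLevel L 3 H v))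
    (hadmn : ∀ (ξ : OneDimAutRepH L) (v : HeightOneSpectrum (𝓞 ↥(maximalRealSubfield L))), (Pk' ξ v).πn.IsAdmissible)
    {t : OneDimAutRepH L → EvpData L H}
    (ht : ∀ (ξ : OneDimAutRepH L), ∀ v ∉ ram ξ, t ξ v = (Pk' ξ v).πn.eigencharacter (cmLocalIntegralLevel L 3 H v) (νG' v))
    (hcore : ∀ (ξ : OneDimAutRepH L) (π : ∀ v : HeightOneSpectrum (𝓞 ↥(maximalRealSubfield L)), IrrClass ((cmDatum L 3 (splitForm L 3)).Local v)),
      F0P3GlobalPacketDiscrete.cmOccursInDiscreteSpectrum L 3 (splitForm L 3) μ π →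
      (∀ᶠ v in cofinite, π v = (transportAPackets ψ Pk' ξ v).πn) →
      ∀ v, π v = (transportAPackets ψ Pk' ξ v).πn ∨ (transportAPackets ψ Pk' ξ v).πs = some (π v))
    (ξ : OneDimAutRepH L) {S : Finset (HeightOneSpectrum (𝓞 ↥(maximalRealSubfield L)))} {Q : SpectralPacketG 𝔩 𝔞 μ}
    (hevp : EqOff L H S (Q.evpGψ ψ (fun w => (νG' w).map (ψ w))) (t ξ)) (v : HeightOneSpectrum (𝓞 ↥(maximalRealSubfield L))) :
    (transportAPackets ψ Pk' ξ v).πn ∈ (𝔩 v).mem (Q.fin.loc v) ∨ ∃ c, (transportAPackets ψ Pk' ξ v).πs = some c ∧ c ∈ (𝔩 v).mem (Q.fin.loc v) := by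
  obtain ⟨π, hπ, hocc⟩ := Q.exists_mem_occurs
  have hmem : π v ∈ (𝔩 v).mem (Q.fin.loc v) := hπ.1 v
  rcases hcore ξ π hocc (eventually_mem_eq_transport_πn_of_eqOff_offS hKG3 S₀ hψK h4 hvol hsph hadmn ht ξ hevp hπ) v with h | h
  · exact Or.inl (h ▸ hmem)
  · exact Or.inr ⟨π v, h, hmem⟩

/-- **ORGAN O3, KIT-GENERIC, (KG1) OFF `S₀` ONLY: (L1″) `XiRigidityGHom` FROM THE MARKER LAWS (KM1)∕(KJ-G)∕(KM2)∕(KM3), (KG1) read off the guard, (KG3′), THE GUARD, `vol(K′_v) ≠ 0`, THE RECORD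
SHAPES AND THE KIT-FREE RIGID CORE** — sibling of ★ `xiRigidityGHom_of_marker_laws_of_core` (p848182), the closer the leaf ED. 7 `stub_PKrigidGOfCore` calls with `h4 := fun v hv => hKG1 v ‹HUR v›`.
[cite: Rogawski1990, §13.3 Thm. 13.3.5 p. 202, Thm. 13.3.6 (c) p. 202, p. 199 ¶2, p. 201 ll. 16–18; §13.2 p. 200 l. 1–3; §13.7 p. 206; §4.5 p. 49; §13.8 p. 216] [cite: CartierCorvallis1979, §IV.1 Cor. 4.1] -/
theorem xiRigidityGHom_of_marker_laws_of_core_offS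
    {h : XiPacketsSignedHom 𝔩 𝔞 μ infOf aTok (transportAPackets ψ Pk') PkInf κ}
    (hKM1 : ∀ (v : HeightOneSpectrum (𝓞 ↥(maximalRealSubfield L))) (P P' : (𝔩 v).Pkt), (𝔩 v).mem P = (𝔩 v).mem P' → (∀ c, (𝔩 v).one P c = (𝔩 v).one P' c) →
      (P ∈ aTok v ↔ P' ∈ aTok v) → P = P')
    (hKJ : ∀ (v : HeightOneSpectrum (𝓞 ↥(maximalRealSubfield L))) (P : (𝔩 v).Pkt) (c : IrrClass ((UnitaryGroup.cmDatum L 3 (splitForm L 3)).Local v)),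
      c ∉ (𝔩 v).mem P → (𝔩 v).one P c = 0)
    (hKM2 : ∀ (ξ : OneDimAutRepH L) (v : HeightOneSpectrum (𝓞 ↥(maximalRealSubfield L))) (P : (𝔩 v).Pkt), P ∉ aTok v →
      (transportAPackets ψ Pk' ξ v).πn ∉ (𝔩 v).mem P)
    (hKM3 : ∀ (ξ : OneDimAutRepH L) (v : HeightOneSpectrum (𝓞 ↥(maximalRealSubfield L))) (P : (𝔩 v).Pkt), P ∈ aTok v →
      ((transportAPackets ψ Pk' ξ v).πn ∈ (𝔩 v).mem P ∨ ∃ c, (transportAPackets ψ Pk' ξ v).πs = some c ∧ c ∈ (𝔩 v).mem P) →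
      (∀ c, c ∈ (𝔩 v).mem P ↔ (c = (transportAPackets ψ Pk' ξ v).πn ∨ (transportAPackets ψ Pk' ξ v).πs = some c)) ∧
        (𝔩 v).one P (transportAPackets ψ Pk' ξ v).πn = 1 ∧ ∀ c ∈ (𝔩 v).mem P, c ≠ (transportAPackets ψ Pk' ξ v).πn → (𝔩 v).one P c = -1)
    (hKG3 : ∀ (v : HeightOneSpectrum (𝓞 ↥(maximalRealSubfield L))) (P : (𝔩 v).Pkt), ∀ π ∈ (𝔩 v).mem P, π.IsAdmissible)
    (S₀ : Finset (HeightOneSpectrum (𝓞 ↥(maximalRealSubfield L))))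
    (hψK : ∀ v ∉ S₀, (cmLocalIntegralLevel L 3 H v).map (ψ v : (cmDatum L 3 H).Local v →* (cmDatum L 3 (splitForm L 3)).Local v) =
      cmLocalIntegralLevel L 3 (splitForm L 3) v)
    (h4 : ∀ v ∉ S₀, (𝔩 v).UnramLaw)
    (hvol : ∀ v : HeightOneSpectrum (𝓞 ↥(maximalRealSubfield L)), (νG' v).real (cmLocalIntegralLevel L 3 H v : Set ((cmDatum L 3 H).Local v)) ≠ 0)
    (hsph : ∀ (ξ : OneDimAutRepH L), ∀ v ∉ ram ξ, (Pk' ξ v).πn.IsSpherical (cmLocalIntegralLevel L 3 H v))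
    (hadmn : ∀ (ξ : OneDimAutRepH L) (v : HeightOneSpectrum (𝓞 ↥(maximalRealSubfield L))), (Pk' ξ v).πn.IsAdmissible)
    {tXi : OneDimAutRepH L → EvpData L H}
    (ht : ∀ (ξ : OneDimAutRepH L), ∀ v ∉ ram ξ, tXi ξ v = (Pk' ξ v).πn.eigencharacter (cmLocalIntegralLevel L 3 H v) (νG' v))
    (hcore : ∀ (ξ : OneDimAutRepH L) (π : ∀ v : HeightOneSpectrum (𝓞 ↥(maximalRealSubfield L)), IrrClass ((cmDatum L 3 (splitForm L 3)).Local v)),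
      F0P3GlobalPacketDiscrete.cmOccursInDiscreteSpectrum L 3 (splitForm L 3) μ π →
      (∀ᶠ v in cofinite, π v = (transportAPackets ψ Pk' ξ v).πn) →
      ∀ v, π v = (transportAPackets ψ Pk' ξ v).πn ∨ (transportAPackets ψ Pk' ξ v).πs = some (π v)) :
    XiRigidityGHom h ψ (fun w => (νG' w).map (ψ w)) tXi :=
  xiRigidityGHom_of_marker_laws_of_meet_offS hKM1 hKJ hKM2 hKM3 hKG3 S₀ hψK h4 hvol hsph hadmn ht
    fun ξ _ Q _ _ hevp _ => meets_of_core_of_eqOff_offS hKG3 S₀ hψK h4 hvol hsph hadmn ht hcore ξ (Q := Q) hevp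

end Summit.HodgeConjecture.HodgeConjecture.Cruxes.H413.F0P3SpectralPacket.SpectralPacketG

/-! ## §2 The `H`-side (O5 path): Satake on `ξ_H(ρ_v)` at the good places, (L3) from the A-fibre and the global `H`-input, (L3) from (KR-1)∕(KR-2) — off `S₀` only [Thm. 13.3.5 for `H`; §13.7] -/

namespace Summit.HodgeConjecture.HodgeConjecture.Cruxes.H413.F0P3SpectralPacket.SpectralPacketH

open Summit.HodgeConjecture.HodgeConjecture.Cruxes.H413.F0P3GlobalPacket

variable {L : Type} [Field L] [NumberField L] [IsCMField L] {H : Matrix (Fin 3) (Fin 3) L}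
  {𝔩 : ∀ v : HeightOneSpectrum (𝓞 ↥(maximalRealSubfield L)), LocalPacketKit L (splitForm L 3) v} {𝔞 : ArchPacketKit} {𝔞H : ArchPacketKitH 𝔞}
  {DiscH : GlobalPacketH 𝔩 → 𝔞H.PktInfH → Prop}
  [∀ v : HeightOneSpectrum (𝓞 ↥(maximalRealSubfield L)), MeasurableSpace ((cmDatum L 3 (splitForm L 3)).Local v)]
  [∀ v : HeightOneSpectrum (𝓞 ↥(maximalRealSubfield L)), BorelSpace ((cmDatum L 3 (splitForm L 3)).Local v)]
  [∀ v : HeightOneSpectrum (𝓞 ↥(maximalRealSubfield L)), MeasurableSpace ((cmDatum L 3 H).Local v)]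
  [∀ v : HeightOneSpectrum (𝓞 ↥(maximalRealSubfield L)), BorelSpace ((cmDatum L 3 H).Local v)]
  {νG' : ∀ v : HeightOneSpectrum (𝓞 ↥(maximalRealSubfield L)), Measure ((cmDatum L 3 H).Local v)}
  [∀ v, (νG' v).IsMulLeftInvariant] [∀ v, IsFiniteMeasureOnCompacts (νG' v)]
  {ψ : ∀ v : HeightOneSpectrum (𝓞 ↥(maximalRealSubfield L)), (cmDatum L 3 H).Local v ≃ₜ* (cmDatum L 3 (splitForm L 3)).Local v}
  {Pk' : OneDimAutRepH L → ∀ v : HeightOneSpectrum (𝓞 ↥(maximalRealSubfield L)), CMLocalAPacket L H v}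
  {ram : OneDimAutRepH L → Finset (HeightOneSpectrum (𝓞 ↥(maximalRealSubfield L)))}

/-- **EVERY GOOD PLACE on the `H`-side, (KG1) off `S₀` only** — sibling of ★ `transport_πn_mem_xiH_of_eqOff`: from `t(ξ_H(ρ)) = t(ξ)` off `S ⊇ ramH ρ`, `(transportAPackets ψ Pk′ ξ v).πn ∈ ξ_H(ρ_v)`
for every `v ∉ S ∪ S₀ ∪ ram ξ`. [cite: Rogawski1990, §13.7 p. 206; §13.3 Thm. 13.3.4, Thm. 13.3.5 p. 202; §12.2 p. 174 l. 1; §4.5 p. 49] [cite: CartierCorvallis1979, §IV.1 Cor. 4.1] -/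
theorem transport_πn_mem_xiH_of_eqOff_offS
    (hKG3 : ∀ (v : HeightOneSpectrum (𝓞 ↥(maximalRealSubfield L))) (P : (𝔩 v).Pkt), ∀ π ∈ (𝔩 v).mem P, π.IsAdmissible)
    (S₀ : Finset (HeightOneSpectrum (𝓞 ↥(maximalRealSubfield L))))
    (hψK : ∀ v ∉ S₀, (cmLocalIntegralLevel L 3 H v).map (ψ v : (cmDatum L 3 H).Local v →* (cmDatum L 3 (splitForm L 3)).Local v) =
      cmLocalIntegralLevel L 3 (splitForm L 3) v)
    (h4 : ∀ v ∉ S₀, (𝔩 v).UnramLaw)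
    (hvol : ∀ v : HeightOneSpectrum (𝓞 ↥(maximalRealSubfield L)), (νG' v).real (cmLocalIntegralLevel L 3 H v : Set ((cmDatum L 3 H).Local v)) ≠ 0)
    (hsph : ∀ (ξ : OneDimAutRepH L), ∀ v ∉ ram ξ, (Pk' ξ v).πn.IsSpherical (cmLocalIntegralLevel L 3 H v))
    (hadmn : ∀ (ξ : OneDimAutRepH L) (v : HeightOneSpectrum (𝓞 ↥(maximalRealSubfield L))), (Pk' ξ v).πn.IsAdmissible)
    {t : OneDimAutRepH L → EvpData L H}
    (ht : ∀ (ξ : OneDimAutRepH L), ∀ v ∉ ram ξ, t ξ v = (Pk' ξ v).πn.eigencharacter (cmLocalIntegralLevel L 3 H v) (νG' v))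
    (ξ : OneDimAutRepH L) {S : Finset (HeightOneSpectrum (𝓞 ↥(maximalRealSubfield L)))} {ρ : SpectralPacketH 𝔩 𝔞 𝔞H DiscH}
    (hevp : EqOff L H S (ρ.evpHψ ψ (fun w => (νG' w).map (ψ w))) (t ξ)) (hram : ρ.ramFinsetH ⊆ S)
    {v : HeightOneSpectrum (𝓞 ↥(maximalRealSubfield L))} (hvS : v ∉ S) (hv₀ : v ∉ S₀) (hvr : v ∉ ram ξ) :
    (transportAPackets ψ Pk' ξ v).πn ∈ (𝔩 v).mem ((𝔩 v).xiH (ρ.fin.loc v)) := by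
  rw [transportAPackets_πn]
  exact ρ.comap_symm_mem_xiH_of_evpHψ_eq (h4 v hv₀) (hKG3 v _) (hψK v hv₀) (hvol v) (ρ.unr_xiH_of_not_mem_ramFinsetH fun h => hvS (hram h)) (hadmn ξ v)
    (hsph ξ v hvr) ((hevp v hvS).trans (ht ξ v hvr))

variable {aTok : ∀ v : HeightOneSpectrum (𝓞 ↥(maximalRealSubfield L)), Set (𝔩 v).Pkt}
  {PkInf : OneDimAutRepH L → LocalAPacket (GKIrrClass (uFormGroup (Fin 2) (Fin 1)))}
  {χ : OneDimAutRepH L → ∀ v : HeightOneSpectrum (𝓞 ↥(maximalRealSubfield L)),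
    (UnitaryGroup.cmDatum L 2 (Matrix.of fun i j : Fin 2 => if i.val + j.val + 1 = 2 then (1 : L) else 0)).Local v ×
      (UnitaryGroup.cmDatum L 1 (Matrix.of fun i j : Fin 1 => if i.val + j.val + 1 = 1 then (1 : L) else 0)).Local v →* ℂˣ}
  {hχ : ∀ (ξ : OneDimAutRepH L) (v : HeightOneSpectrum (𝓞 ↥(maximalRealSubfield L))),
    IsOpen (((χ ξ v).ker : Subgroup ((UnitaryGroup.cmDatum L 2 (Matrix.of fun i j : Fin 2 => if i.val + j.val + 1 = 2 then (1 : L) else 0)).Local v ×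
      (UnitaryGroup.cmDatum L 1 (Matrix.of fun i j : Fin 1 => if i.val + j.val + 1 = 1 then (1 : L) else 0)).Local v)) :
      Set ((UnitaryGroup.cmDatum L 2 (Matrix.of fun i j : Fin 2 => if i.val + j.val + 1 = 2 then (1 : L) else 0)).Local v ×
        (UnitaryGroup.cmDatum L 1 (Matrix.of fun i j : Fin 1 => if i.val + j.val + 1 = 1 then (1 : L) else 0)).Local v))}
  {ε : OneDimAutRepH L → HeightOneSpectrum (𝓞 ↥(maximalRealSubfield L)) → ℤ} {κH : OneDimAutRepH L → ℤ}

/-- **(L3) `XiRigidityH` FROM (KD3), THE A-FIBRE, SATAKE OFF `S₀` AND ONE GLOBAL `H`-INPUT, (KG1) off `S₀` only** — sibling of ★ `xiRigidityH_of_fibre` (p848117).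
[cite: Rogawski1990, §13.3 Thm. 13.3.5 p. 202, p. 203; §13.7 p. 206; §14.6 (14.6.3) p. 243; §4.5 p. 49] [cite: CartierCorvallis1979, §IV.1 Cor. 4.1] -/
theorem xiRigidityH_of_fibre_offS {hH : XiHPacketsSigned 𝔩 𝔞 𝔞H DiscH (transportAPackets ψ Pk') PkInf χ hχ ε κH}
    (hKD3 : ∀ (σ : GlobalPacketH 𝔩) (P P' : 𝔞H.PktInfH), DiscH σ P → DiscH σ P' → P = P')
    (hfibH : ∀ (ξ : OneDimAutRepH L) (v : HeightOneSpectrum (𝓞 ↥(maximalRealSubfield L))) (r : (𝔩 v).PktH),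
      (transportAPackets ψ Pk' ξ v).πn ∈ (𝔩 v).mem ((𝔩 v).xiH r) → r = (rhoXiS hH ξ).fin.loc v)
    (hKG3 : ∀ (v : HeightOneSpectrum (𝓞 ↥(maximalRealSubfield L))) (P : (𝔩 v).Pkt), ∀ π ∈ (𝔩 v).mem P, π.IsAdmissible)
    (S₀ : Finset (HeightOneSpectrum (𝓞 ↥(maximalRealSubfield L))))
    (hψK : ∀ v ∉ S₀, (cmLocalIntegralLevel L 3 H v).map (ψ v : (cmDatum L 3 H).Local v →* (cmDatum L 3 (splitForm L 3)).Local v) =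
      cmLocalIntegralLevel L 3 (splitForm L 3) v)
    (h4 : ∀ v ∉ S₀, (𝔩 v).UnramLaw)
    (hvol : ∀ v : HeightOneSpectrum (𝓞 ↥(maximalRealSubfield L)), (νG' v).real (cmLocalIntegralLevel L 3 H v : Set ((cmDatum L 3 H).Local v)) ≠ 0)
    (hsph : ∀ (ξ : OneDimAutRepH L), ∀ v ∉ ram ξ, (Pk' ξ v).πn.IsSpherical (cmLocalIntegralLevel L 3 H v))
    (hadmn : ∀ (ξ : OneDimAutRepH L) (v : HeightOneSpectrum (𝓞 ↥(maximalRealSubfield L))), (Pk' ξ v).πn.IsAdmissible)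
    {tXi : OneDimAutRepH L → EvpData L H}
    (ht : ∀ (ξ : OneDimAutRepH L), ∀ v ∉ ram ξ, tXi ξ v = (Pk' ξ v).πn.eigencharacter (cmLocalIntegralLevel L 3 H v) (νG' v))
    (hglobH : ∀ (ξ : OneDimAutRepH L) (S : Finset (HeightOneSpectrum (𝓞 ↥(maximalRealSubfield L)))) (ρ : SpectralPacketH 𝔩 𝔞 𝔞H DiscH),
      EqOff L H S (ρ.evpHψ ψ (fun w => (νG' w).map (ψ w))) (tXi ξ) → ρ.ramFinsetH ⊆ S →
      (∀ v, v ∉ S → v ∉ S₀ → v ∉ ram ξ → ρ.fin.loc v = (rhoXiS hH ξ).fin.loc v) → ∀ v, ρ.fin.loc v = (rhoXiS hH ξ).fin.loc v) :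
    XiRigidityH hH ψ (fun w => (νG' w).map (ψ w)) tXi := by
  intro ξ S ρ hevp hram
  refine eq_of_loc_eq_of_discH_pins hKD3 (hglobH ξ S ρ hevp hram fun v hvS hv₀ hvr => ?_)
  exact hfibH ξ v _ (transport_πn_mem_xiH_of_eqOff_offS hKG3 S₀ hψK h4 hvol hsph hadmn ht ξ hevp hram hvS hv₀ hvr)

/-- **(L3) `XiRigidityH` FROM THE MARKER LAWS + (KD3) + `ξ_H`-INJECTIVITY ON THE A-FIBRE + SATAKE OFF `S₀` + ONE GLOBAL `H`-INPUT, (KG1) off `S₀` only** — sibling of ★ `xiRigidityH_of_marker_laws`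
(★ `fibreH_of_marker_laws` feeding `xiRigidityH_of_fibre_offS`). [cite: Rogawski1990, §13.3 Thm. 13.3.5 p. 202, Thm. 13.3.4 p. 202, p. 203; §13.1 p. 199 ¶2; §13.2 p. 200 l. 1–3; §13.7 p. 206]
[cite: CartierCorvallis1979, §IV.1 Cor. 4.1] -/
theorem xiRigidityH_of_marker_laws_offS {hH : XiHPacketsSigned 𝔩 𝔞 𝔞H DiscH (transportAPackets ψ Pk') PkInf χ hχ ε κH}
    (hKM1 : ∀ (v : HeightOneSpectrum (𝓞 ↥(maximalRealSubfield L))) (P P' : (𝔩 v).Pkt), (𝔩 v).mem P = (𝔩 v).mem P' → (∀ c, (𝔩 v).one P c = (𝔩 v).one P' c) →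
      (P ∈ aTok v ↔ P' ∈ aTok v) → P = P')
    (hKJ : ∀ (v : HeightOneSpectrum (𝓞 ↥(maximalRealSubfield L))) (P : (𝔩 v).Pkt) (c : IrrClass ((UnitaryGroup.cmDatum L 3 (splitForm L 3)).Local v)),
      c ∉ (𝔩 v).mem P → (𝔩 v).one P c = 0)
    (hKM2 : ∀ (ξ : OneDimAutRepH L) (v : HeightOneSpectrum (𝓞 ↥(maximalRealSubfield L))) (P : (𝔩 v).Pkt), P ∉ aTok v →
      (transportAPackets ψ Pk' ξ v).πn ∉ (𝔩 v).mem P)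
    (hKM3 : ∀ (ξ : OneDimAutRepH L) (v : HeightOneSpectrum (𝓞 ↥(maximalRealSubfield L))) (P : (𝔩 v).Pkt), P ∈ aTok v →
      ((transportAPackets ψ Pk' ξ v).πn ∈ (𝔩 v).mem P ∨ ∃ c, (transportAPackets ψ Pk' ξ v).πs = some c ∧ c ∈ (𝔩 v).mem P) →
      (∀ c, c ∈ (𝔩 v).mem P ↔ (c = (transportAPackets ψ Pk' ξ v).πn ∨ (transportAPackets ψ Pk' ξ v).πs = some c)) ∧
        (𝔩 v).one P (transportAPackets ψ Pk' ξ v).πn = 1 ∧ ∀ c ∈ (𝔩 v).mem P, c ≠ (transportAPackets ψ Pk' ξ v).πn → (𝔩 v).one P c = -1)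
    (hKD3 : ∀ (σ : GlobalPacketH 𝔩) (P P' : 𝔞H.PktInfH), DiscH σ P → DiscH σ P' → P = P')
    (hinj : ∀ (ξ : OneDimAutRepH L) (v : HeightOneSpectrum (𝓞 ↥(maximalRealSubfield L))) (r : (𝔩 v).PktH),
      (𝔩 v).xiH r = (𝔩 v).xiH ((rhoXiS hH ξ).fin.loc v) → r = (rhoXiS hH ξ).fin.loc v)
    (hKG3 : ∀ (v : HeightOneSpectrum (𝓞 ↥(maximalRealSubfield L))) (P : (𝔩 v).Pkt), ∀ π ∈ (𝔩 v).mem P, π.IsAdmissible)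
    (S₀ : Finset (HeightOneSpectrum (𝓞 ↥(maximalRealSubfield L))))
    (hψK : ∀ v ∉ S₀, (cmLocalIntegralLevel L 3 H v).map (ψ v : (cmDatum L 3 H).Local v →* (cmDatum L 3 (splitForm L 3)).Local v) =
      cmLocalIntegralLevel L 3 (splitForm L 3) v)
    (h4 : ∀ v ∉ S₀, (𝔩 v).UnramLaw)
    (hvol : ∀ v : HeightOneSpectrum (𝓞 ↥(maximalRealSubfield L)), (νG' v).real (cmLocalIntegralLevel L 3 H v : Set ((cmDatum L 3 H).Local v)) ≠ 0)
    (hsph : ∀ (ξ : OneDimAutRepH L), ∀ v ∉ ram ξ, (Pk' ξ v).πn.IsSpherical (cmLocalIntegralLevel L 3 H v))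
    (hadmn : ∀ (ξ : OneDimAutRepH L) (v : HeightOneSpectrum (𝓞 ↥(maximalRealSubfield L))), (Pk' ξ v).πn.IsAdmissible)
    {tXi : OneDimAutRepH L → EvpData L H}
    (ht : ∀ (ξ : OneDimAutRepH L), ∀ v ∉ ram ξ, tXi ξ v = (Pk' ξ v).πn.eigencharacter (cmLocalIntegralLevel L 3 H v) (νG' v))
    (hglobH : ∀ (ξ : OneDimAutRepH L) (S : Finset (HeightOneSpectrum (𝓞 ↥(maximalRealSubfield L)))) (ρ : SpectralPacketH 𝔩 𝔞 𝔞H DiscH),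
      EqOff L H S (ρ.evpHψ ψ (fun w => (νG' w).map (ψ w))) (tXi ξ) → ρ.ramFinsetH ⊆ S →
      (∀ v, v ∉ S → v ∉ S₀ → v ∉ ram ξ → ρ.fin.loc v = (rhoXiS hH ξ).fin.loc v) → ∀ v, ρ.fin.loc v = (rhoXiS hH ξ).fin.loc v) :
    XiRigidityH hH ψ (fun w => (νG' w).map (ψ w)) tXi :=
  xiRigidityH_of_fibre_offS hKD3 (fibreH_of_marker_laws hH hKM1 hKJ hKM2 hKM3 hinj) hKG3 S₀ hψK h4 hvol hsph hadmn ht hglobH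

/-- **(L3) `XiRigidityH` FROM (KD1) + (KD3) + (KR-1) + (KR-2) AND THE KIT∕RECORD FACTS, (KG1) off `S₀` only** — sibling of ★ `xiRigidityH_of_KR` (p848874), the closer the leaf ED. 7
`stub_PKrigidHOfKR` calls with `h4 := fun v hv => hKG1 v ‹HUR v›`: the A-fibre from (KR-1)+(KD1) (★ `fibreH_of_KR1`), the global `H`-input from (KR-2)+(KD1) (★ `globH_of_KR2`), Satake off `S₀`.
[cite: Rogawski1990, §13.3 Thm. 13.3.5 p. 202, Thms. 13.3.2∕13.3.4 p. 202, p. 203; §13.1 p. 199 ¶2; §13.7 p. 206; §4.5 p. 49; §13.8 p. 216] [cite: CartierCorvallis1979, §IV.1 Cor. 4.1] -/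
theorem xiRigidityH_of_KR_offS {hH : XiHPacketsSigned 𝔩 𝔞 𝔞H DiscH (transportAPackets ψ Pk') PkInf χ hχ ε κH}
    (hKD1 : ∀ (v : HeightOneSpectrum (𝓞 ↥(maximalRealSubfield L))) (ρ ρ' : (𝔩 v).PktH), (𝔩 v).memH ρ = (𝔩 v).memH ρ' → ρ = ρ')
    (hKD3 : ∀ (σ : GlobalPacketH 𝔩) (P P' : 𝔞H.PktInfH), DiscH σ P → DiscH σ P' → P = P')
    (hKR1 : ∀ (ξ : OneDimAutRepH L) (v : HeightOneSpectrum (𝓞 ↥(maximalRealSubfield L))) (r : (𝔩 v).PktH),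
      (transportAPackets ψ Pk' ξ v).πn ∈ (𝔩 v).mem ((𝔩 v).xiH r) → (𝔩 v).memH r = {IrrClass.mk (SmoothIrrep.ofChar (χ ξ v) (hχ ξ v))})
    (hKR2 : ∀ (ρ : SpectralPacketH 𝔩 𝔞 𝔞H DiscH) (ξ : OneDimAutRepH L) (T : Finset (HeightOneSpectrum (𝓞 ↥(maximalRealSubfield L)))),
      (∀ v ∉ T, (𝔩 v).memH (ρ.fin.loc v) = {IrrClass.mk (SmoothIrrep.ofChar (χ ξ v) (hχ ξ v))}) →
      ∀ v, (𝔩 v).memH (ρ.fin.loc v) = {IrrClass.mk (SmoothIrrep.ofChar (χ ξ v) (hχ ξ v))})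
    (hKG3 : ∀ (v : HeightOneSpectrum (𝓞 ↥(maximalRealSubfield L))) (P : (𝔩 v).Pkt), ∀ π ∈ (𝔩 v).mem P, π.IsAdmissible)
    (S₀ : Finset (HeightOneSpectrum (𝓞 ↥(maximalRealSubfield L))))
    (hψK : ∀ v ∉ S₀, (cmLocalIntegralLevel L 3 H v).map (ψ v : (cmDatum L 3 H).Local v →* (cmDatum L 3 (splitForm L 3)).Local v) =
      cmLocalIntegralLevel L 3 (splitForm L 3) v)
    (h4 : ∀ v ∉ S₀, (𝔩 v).UnramLaw)
    (hvol : ∀ v : HeightOneSpectrum (𝓞 ↥(maximalRealSubfield L)), (νG' v).real (cmLocalIntegralLevel L 3 H v : Set ((cmDatum L 3 H).Local v)) ≠ 0)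
    (hsph : ∀ (ξ : OneDimAutRepH L), ∀ v ∉ ram ξ, (Pk' ξ v).πn.IsSpherical (cmLocalIntegralLevel L 3 H v))
    (hadmn : ∀ (ξ : OneDimAutRepH L) (v : HeightOneSpectrum (𝓞 ↥(maximalRealSubfield L))), (Pk' ξ v).πn.IsAdmissible)
    {tXi : OneDimAutRepH L → EvpData L H}
    (ht : ∀ (ξ : OneDimAutRepH L), ∀ v ∉ ram ξ, tXi ξ v = (Pk' ξ v).πn.eigencharacter (cmLocalIntegralLevel L 3 H v) (νG' v)) :
    XiRigidityH hH ψ (fun w => (νG' w).map (ψ w)) tXi := by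
  classical
  refine xiRigidityH_of_fibre_offS hKD3 (fun ξ v r hmem => fibreH_of_KR1 hH hKD1 hKR1 ξ v r (by rwa [transportAPackets_πn] at hmem ⊢)) hKG3 S₀ hψK h4 hvol hsph hadmn ht
    fun ξ S ρ _ _ hoff => ?_
  exact globH_of_KR2 hH hKD1 hKR2 ξ ρ (S ∪ S₀ ∪ ram ξ) fun v hv => by
    simp only [Finset.mem_union, not_or] at hv
    exact hoff v hv.1.1 hv.1.2 hv.2

end Summit.HodgeConjecture.HodgeConjecture.Cruxes.H413.F0P3SpectralPacket.SpectralPacketH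

end
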